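import Summits.Ventures.PercRepro.SMC
import Summits.Ventures.PercRepro.Support

/-!
# C-026 at the probability level: the one-edge recursion M3-REC, the contraction condition (Con)
and `c026_of_con` (p5, gen 8)

Mine-3's dossier §15–§16 (`proofs/MINE3-Q3-proof.md`; lead rulings 2082 (3), (ih)(2)): for marks
`a, b, c` write `D = {c ~ a ∨ c ~ b}` and `A = {a ~ b}`; the **C-026 slack** is
`f(G) = P(D ∖ A) − Cov(1_D, 1_A)`, in the rows `x, y₁, y₂, y₃, z` of `law3`
`f = (y₁ + y₂ + y₃) − (x + y₁)(y₁ + z)` (**`slack26`**, so C-026 is `0 ≤ f`; it is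
`G.quadForm p ![a, b, c] kernel26` of `C026.lean`).  At the probability level the minors `G − e`
and `G/e` are the laws at `p[e := 0]` and `p[e := 1]` (`prob_split`), and the law of total
covariance at the edge `e` is the exact recursion

* **M3-REC** (`c026_rec`):
  `f(p) = p_e · f(p[e:=1]) + (1 − p_e) · f(p[e:=0]) − p_e (1 − p_e) · I_D · I_A`,
  with the pivotal differences `I_D = P_{p[e:=1]}(D) − P_{p[e:=0]}(D)` (**`pivD26`**) and
  `I_A = P_{p[e:=1]}(A) − P_{p[e:=0]}(A)` (**`pivA26`**), both `≥ 0` (`D`, `A` are increasing).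

Consequences (the "3-line algebraic lemmas"):

* **`c026_of_con`** — the **contraction condition (Con)_e** `f(p[e:=1]) ≥ I_D · I_A`
  (**`Con26`**) at ONE edge together with `f(p[e:=0]) ≥ 0` gives
  `f(p) ≥ p_e² · I_D · I_A ≥ 0` (`c026_of_con_sq`);
* **`c026_of_mix`** — likewise from **(Mix)_e** `f(p[e:=0]) + f(p[e:=1]) ≥ I_D · I_A`
  (**`Mix26`**) when both minors satisfy C-026;
* **`C026_of_conCEdges`** — the bridge of record: if (Con) holds at every non-loop edge at `c`
  (`IsCEdge`) of every marked multigraph — **`ConCEdges`**, mine-3's candidate step (Con)_cv,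
  a `def` (its census: every c–non-mark edge, 0 violations; at the mark–mark edges `ca`, `cb`
  the step is the free one of §15.2 (ii)) — then C-026 holds: induction on the number of
  edges at `c` that are not surely closed, `c026_of_con` at such an edge; when every edge at
  `c` is surely closed, `c` is isolated (`prob_connEvent_eq_zero_of_closed_at`) and
  `f = y₁ (1 − y₁ − z) ≥ 0`, or `f = y₂ + y₃ ≥ 0` when `c ∈ {a, b}`
  (`slack26_nonneg_of_closed_at_c`).
-/

namespace PercRepro

open Finset

namespace MultiGraph

variable {V E : Type*} (G : MultiGraph V E) [Fintype E] [DecidableEq E]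

/-! ### The slack and the two pivotal differences -/

/-- **The C-026 slack** `f(G) = (y₁ + y₂ + y₃) − (x + y₁)(y₁ + z)` in the `law3` rows:
C-026 for `(G, p, a, b, c)` is `0 ≤ f`. -/
noncomputable def slack26 (p : E → ℝ) (a b c : V) : ℝ :=
  (G.law3 p a b c 1 + G.law3 p a b c 2 + G.law3 p a b c 3) -
    (G.law3 p a b c 0 + G.law3 p a b c 1) * (G.law3 p a b c 1 + G.law3 p a b c 4)

/-- `P(a ~ b) = x + y₁` in the rows. -/
theorem law3_zero_add_one (p : E → ℝ) (a b c : V) :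
    G.law3 p a b c 0 + G.law3 p a b c 1 = prob p (G.connEvent a b) := by
  rw [law3_zero, law3_one, G.partitionEvent_row_abc, G.partitionEvent_row_ab_c]
  have h := prob_inter_add_prob_inter_compl p (G.connEvent a b) (G.connEvent b c)
  have e3 : G.connEvent a b ∩ (G.connEvent b c)ᶜ = G.connEvent a b ∩ G.sepEvent a c := by
    ext ω
    obtain ⟨h1, h2, h3⟩ := G.conn_three_trans a b c (ω := ω)
    simp only [Set.mem_inter_iff, Set.mem_compl_iff, mem_connEvent, mem_sepEvent]
    tauto
  rw [e3] at h
  linarith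

/-- `P(c ≁ a ∧ c ≁ b) = y₁ + z` in the rows — the complement of `D = {c ~ a ∨ c ~ b}`. -/
theorem law3_one_add_four (p : E → ℝ) (a b c : V) :
    G.law3 p a b c 1 + G.law3 p a b c 4 = prob p (G.sepEvent a c ∩ G.sepEvent b c) := by
  rw [law3_one, law3_four, G.partitionEvent_row_ab_c, G.partitionEvent_row_a_b_c]
  have h := prob_inter_add_prob_inter_compl p (G.sepEvent a c ∩ G.sepEvent b c)
    (G.connEvent a b)
  have e1 : G.sepEvent a c ∩ G.sepEvent b c ∩ G.connEvent a b =
      G.connEvent a b ∩ G.sepEvent a c := by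
    ext ω
    obtain ⟨h1, h2, h3⟩ := G.conn_three_trans a b c (ω := ω)
    simp only [Set.mem_inter_iff, mem_connEvent, mem_sepEvent]
    tauto
  have e2 : G.sepEvent a c ∩ G.sepEvent b c ∩ (G.connEvent a b)ᶜ =
      G.sepEvent a b ∩ G.sepEvent a c ∩ G.sepEvent b c := by
    ext ω
    simp only [Set.mem_inter_iff, Set.mem_compl_iff, mem_connEvent, mem_sepEvent]
    tauto
  rw [e1, e2] at h
  linarith

/-- **`I_A`**, the pivotal difference of `e` for `A = {a ~ b}`:
`P_{p[e:=1]}(a ~ b) − P_{p[e:=0]}(a ~ b)`, written in the rows. -/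
noncomputable def pivA26 (p : E → ℝ) (e : E) (a b c : V) : ℝ :=
  (G.law3 (Function.update p e 1) a b c 0 + G.law3 (Function.update p e 1) a b c 1) -
    (G.law3 (Function.update p e 0) a b c 0 + G.law3 (Function.update p e 0) a b c 1)

/-- **`I_D`**, the pivotal difference of `e` for `D = {c ~ a ∨ c ~ b}`:
`P_{p[e:=1]}(D) − P_{p[e:=0]}(D) = P_{p[e:=0]}(c ≁ a ∧ c ≁ b) − P_{p[e:=1]}(c ≁ a ∧ c ≁ b)`,
written in the rows. -/
noncomputable def pivD26 (p : E → ℝ) (e : E) (a b c : V) : ℝ :=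
  (G.law3 (Function.update p e 0) a b c 1 + G.law3 (Function.update p e 0) a b c 4) -
    (G.law3 (Function.update p e 1) a b c 1 + G.law3 (Function.update p e 1) a b c 4)

/-- `I_A` as a difference of connection probabilities. -/
theorem pivA26_eq (p : E → ℝ) (e : E) (a b c : V) :
    G.pivA26 p e a b c = prob (Function.update p e 1) (G.connEvent a b) -
      prob (Function.update p e 0) (G.connEvent a b) := by
  unfold pivA26
  rw [law3_zero_add_one, law3_zero_add_one]

/-- `I_D` as a difference of separation probabilities. -/
theorem pivD26_eq (p : E → ℝ) (e : E) (a b c : V) :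
    G.pivD26 p e a b c = prob (Function.update p e 0) (G.sepEvent a c ∩ G.sepEvent b c) -
      prob (Function.update p e 1) (G.sepEvent a c ∩ G.sepEvent b c) := by
  unfold pivD26
  rw [law3_one_add_four, law3_one_add_four]

/-- `I_A ≥ 0`: `a ~ b` is increasing. -/
theorem pivA26_nonneg {p : E → ℝ} (hp : IsProb p) (e : E) (a b c : V) :
    0 ≤ G.pivA26 p e a b c := by
  rw [pivA26_eq]
  exact sub_nonneg.2 (prob_update_zero_le_prob_update_one hp e (G.isUpperSet_connEvent a b))

omit [Fintype E] in
/-- `p[e:=0] ≤ p[e:=1]` pointwise. -/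
theorem update_zero_le_update_one (p : E → ℝ) (e : E) :
    Function.update p e 0 ≤ Function.update p e 1 := by
  intro e'
  by_cases h : e' = e
  · subst h
    simp
  · rw [Function.update_of_ne h, Function.update_of_ne h]

/-- `I_D ≥ 0`: `c ≁ a ∧ c ≁ b` is decreasing. -/
theorem pivD26_nonneg {p : E → ℝ} (hp : IsProb p) (e : E) (a b c : V) :
    0 ≤ G.pivD26 p e a b c := by
  rw [pivD26_eq]
  refine sub_nonneg.2 (prob_anti_of_isLowerSet (hp.update e ⟨le_rfl, zero_le_one⟩)
    (hp.update e ⟨zero_le_one, le_rfl⟩) (update_zero_le_update_one p e) ?_)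
  exact (G.isLowerSet_sepEvent a c).inter (G.isLowerSet_sepEvent b c)

/-! ### M3-REC: the exact one-edge recursion -/

/-- **M3-REC** (mine-3 §15.2 (R), the law of total covariance at the edge `e`):
`f(p) = p_e · f(p[e:=1]) + (1 − p_e) · f(p[e:=0]) − p_e (1 − p_e) · I_D · I_A`. -/
theorem c026_rec (p : E → ℝ) (e : E) (a b c : V) :
    G.slack26 p a b c =
      p e * G.slack26 (Function.update p e 1) a b c +
        (1 - p e) * G.slack26 (Function.update p e 0) a b c -
        p e * (1 - p e) * (G.pivD26 p e a b c * G.pivA26 p e a b c) := by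
  have h : ∀ s, G.law3 p a b c s =
      p e * G.law3 (Function.update p e 1) a b c s +
        (1 - p e) * G.law3 (Function.update p e 0) a b c s :=
    fun s => prob_split p e _
  unfold slack26 pivD26 pivA26
  rw [h 0, h 1, h 2, h 3, h 4]
  ring

/-! ### (Con), (Mix) and the one-step lemmas -/

/-- **The contraction condition (Con)_e** (mine-3 §16.1): `f(G/e) ≥ I_D · I_A`, i.e.
`pivD26 · pivA26 ≤ slack26 (p[e:=1])`.  A statement, never assumed without saying so. -/
def Con26 (p : E → ℝ) (e : E) (a b c : V) : Prop :=
  G.pivD26 p e a b c * G.pivA26 p e a b c ≤ G.slack26 (Function.update p e 1) a b c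

/-- **The mixing condition (Mix)_e** (mine-3 §15.2 (i)): `f(G − e) + f(G/e) ≥ I_D · I_A`. -/
def Mix26 (p : E → ℝ) (e : E) (a b c : V) : Prop :=
  G.pivD26 p e a b c * G.pivA26 p e a b c ≤
    G.slack26 (Function.update p e 0) a b c + G.slack26 (Function.update p e 1) a b c

/-- (Con)_e implies (Mix)_e when `G − e` satisfies C-026. -/
theorem Mix26_of_Con26 {p : E → ℝ} {e : E} {a b c : V} (hcon : G.Con26 p e a b c)
    (h0 : 0 ≤ G.slack26 (Function.update p e 0) a b c) : G.Mix26 p e a b c := by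
  unfold Con26 at hcon
  unfold Mix26
  linarith

/-- **The quantitative step** (lead 2082 (1)): (Con)_e and `f(G − e) ≥ 0` give
`f(G) ≥ p_e² · I_D · I_A`. -/
theorem c026_of_con_sq {p : E → ℝ} (hp : IsProb p) {e : E} {a b c : V}
    (hcon : G.Con26 p e a b c) (h0 : 0 ≤ G.slack26 (Function.update p e 0) a b c) :
    p e ^ 2 * (G.pivD26 p e a b c * G.pivA26 p e a b c) ≤ G.slack26 p a b c := by
  have hq := hp e
  have hDA : 0 ≤ G.pivD26 p e a b c * G.pivA26 p e a b c :=
    mul_nonneg (G.pivD26_nonneg hp e a b c) (G.pivA26_nonneg hp e a b c)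
  rw [G.c026_rec p e a b c]
  unfold Con26 at hcon
  nlinarith [mul_le_mul_of_nonneg_left hcon hq.1, mul_nonneg (sub_nonneg.2 hq.2) h0]

/-- **`c026_of_con`** (mine-3 §16.1; the 3-line lemma of lead 2082 (3)): the contraction
condition at ONE edge `e` and C-026 for `G − e` give C-026 for `G`. -/
theorem c026_of_con {p : E → ℝ} (hp : IsProb p) {e : E} {a b c : V}
    (hcon : G.Con26 p e a b c) (h0 : 0 ≤ G.slack26 (Function.update p e 0) a b c) :
    0 ≤ G.slack26 p a b c := by
  have hDA : 0 ≤ G.pivD26 p e a b c * G.pivA26 p e a b c :=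
    mul_nonneg (G.pivD26_nonneg hp e a b c) (G.pivA26_nonneg hp e a b c)
  exact le_trans (mul_nonneg (sq_nonneg (p e)) hDA) (G.c026_of_con_sq hp hcon h0)

/-- **`c026_of_mix`** (mine-3 §15.2 (i)): (Mix)_e and C-026 for both minors give C-026 for `G`
(`p_e (1 − p_e) ≤ min (p_e, 1 − p_e)`). -/
theorem c026_of_mix {p : E → ℝ} (hp : IsProb p) {e : E} {a b c : V}
    (hmix : G.Mix26 p e a b c) (h0 : 0 ≤ G.slack26 (Function.update p e 0) a b c)
    (h1 : 0 ≤ G.slack26 (Function.update p e 1) a b c) : 0 ≤ G.slack26 p a b c := by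
  have hq := hp e
  have h1q : 0 ≤ 1 - p e := sub_nonneg.2 hq.2
  rw [G.c026_rec p e a b c]
  unfold Mix26 at hmix
  nlinarith [mul_le_mul_of_nonneg_left hmix (mul_nonneg hq.1 h1q),
    mul_nonneg (mul_nonneg hq.1 hq.1) h1, mul_nonneg (mul_nonneg h1q h1q) h0]

/-! ### Edges at `c`; the isolated-`c` base case -/

/-- A **`c`-edge**: a non-loop edge with `c` as an endpoint. -/
def IsCEdge (c : V) (e : E) : Prop := (G.fst e = c ∨ G.snd e = c) ∧ G.fst e ≠ G.snd e

/-- If every edge at `c` is surely closed, `c` reaches no other vertex almost surely. -/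
theorem prob_connEvent_eq_zero_of_closed_at {p : E → ℝ} {c : V}
    (hc : ∀ e, G.IsCEdge c e → p e = 0) {x : V} (hx : x ≠ c) :
    prob p (G.connEvent c x) = 0 := by
  refine prob_eq_zero_of_forall_weight_eq_zero p fun ω hω => ?_
  by_contra hw
  apply hx
  refine G.mem_of_conn_of_closed_boundary (X := {c}) (fun e he => ?_) (Set.mem_singleton c) hω
  simp only [Set.mem_singleton_iff]
  by_cases hfs : G.fst e = G.snd e
  · rw [hfs]
  · have hne : ¬ G.IsCEdge c e := fun h => by
      have := eq_false_of_weight_ne_zero_of_eq_zero hw (hc e h)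
      rw [he] at this
      exact Bool.noConfusion this
    have hne' : ¬ (G.fst e = c ∨ G.snd e = c) := fun h => hne ⟨h, hfs⟩
    constructor
    · intro h1
      exact absurd (Or.inl h1) hne'
    · intro h2
      exact absurd (Or.inr h2) hne'

/-- **The base case**: if every edge at `c` is surely closed, `f ≥ 0` — when `c ∉ {a, b}` the
rows `x, y₂, y₃` vanish and `f = y₁ (1 − y₁ − z) ≥ 0`; when `c ∈ {a, b}` the rows `y₁, z`
vanish and `f = y₂ + y₃ ≥ 0`. -/
theorem slack26_nonneg_of_closed_at_c {p : E → ℝ} (hp : IsProb p) {a b c : V}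
    (hc : ∀ e, G.IsCEdge c e → p e = 0) : 0 ≤ G.slack26 p a b c := by
  have hx : 0 ≤ G.law3 p a b c 0 := prob_nonneg hp _
  have hy1 : 0 ≤ G.law3 p a b c 1 := prob_nonneg hp _
  have hy2 : 0 ≤ G.law3 p a b c 2 := prob_nonneg hp _
  have hy3 : 0 ≤ G.law3 p a b c 3 := prob_nonneg hp _
  have hz : 0 ≤ G.law3 p a b c 4 := prob_nonneg hp _
  by_cases hca : c = a
  · subst hca
    have h1 : G.law3 p c b c 1 = 0 := by
      rw [law3_one, G.partitionEvent_row_ab_c, ← prob_empty p]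
      congr 1
      ext ω
      simp only [Set.mem_inter_iff, mem_connEvent, mem_sepEvent, Set.mem_empty_iff_false,
        iff_false]
      exact fun h => h.2 (Conn.refl G ω c)
    have h4 : G.law3 p c b c 4 = 0 := by
      rw [law3_four, G.partitionEvent_row_a_b_c, ← prob_empty p]
      congr 1
      ext ω
      simp only [Set.mem_inter_iff, mem_sepEvent, Set.mem_empty_iff_false, iff_false]
      exact fun h => h.1.2 (Conn.refl G ω c)
    unfold slack26
    rw [h1, h4]
    nlinarith
  by_cases hcb : c = b
  · subst hcb
    have h1 : G.law3 p a c c 1 = 0 := by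
      rw [law3_one, G.partitionEvent_row_ab_c, ← prob_empty p]
      congr 1
      ext ω
      simp only [Set.mem_inter_iff, mem_connEvent, mem_sepEvent, Set.mem_empty_iff_false,
        iff_false]
      exact fun h => h.2 h.1
    have h4 : G.law3 p a c c 4 = 0 := by
      rw [law3_four, G.partitionEvent_row_a_b_c, ← prob_empty p]
      congr 1
      ext ω
      simp only [Set.mem_inter_iff, mem_sepEvent, Set.mem_empty_iff_false, iff_false]
      exact fun h => h.2 (Conn.refl G ω c)
    unfold slack26
    rw [h1, h4]
    nlinarith
  -- `c ∉ {a, b}`: `c` is isolated, so `x = y₂ = y₃ = 0`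
  have hca' : prob p (G.connEvent a c) = 0 := by
    rw [G.connEvent_comm]
    exact G.prob_connEvent_eq_zero_of_closed_at hc (Ne.symm hca)
  have hcb' : prob p (G.connEvent b c) = 0 := by
    rw [G.connEvent_comm]
    exact G.prob_connEvent_eq_zero_of_closed_at hc (Ne.symm hcb)
  have hx0 : G.law3 p a b c 0 = 0 := by
    refine le_antisymm ?_ hx
    rw [law3_zero, G.partitionEvent_row_abc, ← hcb']
    exact prob_inter_le_right hp _ _
  have hy20 : G.law3 p a b c 2 = 0 := by
    refine le_antisymm ?_ hy2
    rw [law3_two, G.partitionEvent_row_ac_b, ← hca']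
    exact prob_inter_le_left hp _ _
  have hy30 : G.law3 p a b c 3 = 0 := by
    refine le_antisymm ?_ hy3
    rw [law3_three, G.partitionEvent_row_bc_a, ← hcb']
    exact prob_inter_le_left hp _ _
  have hle : G.law3 p a b c 1 + G.law3 p a b c 4 ≤ 1 := by
    rw [law3_one_add_four]
    exact prob_le_one hp _
  unfold slack26
  rw [hx0, hy20, hy30]
  nlinarith [mul_nonneg hy1 (sub_nonneg.2 hle)]

/-! ### The bridge: (Con) at every edge at `c` gives C-026 -/

/-- The edges at `c` that are not surely closed (the induction measure). -/
noncomputable def liveCEdges (p : E → ℝ) (c : V) : Finset E := by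
  classical exact univ.filter fun e => G.IsCEdge c e ∧ p e ≠ 0

/-- Surely closing a live edge at `c` removes it from the live set. -/
theorem liveCEdges_update_zero (p : E → ℝ) (c : V) (e : E) :
    G.liveCEdges (Function.update p e 0) c = (G.liveCEdges p c).erase e := by
  classical
  unfold liveCEdges
  ext e'
  simp only [Finset.mem_filter, Finset.mem_univ, true_and, Finset.mem_erase]
  by_cases h : e' = e
  · subst h
    simp
  · rw [Function.update_of_ne h]
    tauto

/-- **The induction** behind the bridge: if (Con) holds at every live edge at `c` of every
`p' ∈ [0,1]^E` (on this graph, these marks), then `f ≥ 0` — strong induction on the number of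
live edges at `c`, `c026_of_con` at one of them, `slack26_nonneg_of_closed_at_c` at the bottom. -/
theorem slack26_nonneg_of_con_at_c {a b c : V}
    (hcon : ∀ p : E → ℝ, IsProb p → ∀ e, G.IsCEdge c e → p e ≠ 0 → G.Con26 p e a b c) :
    ∀ (n : ℕ) (p : E → ℝ), IsProb p → (G.liveCEdges p c).card = n → 0 ≤ G.slack26 p a b c := by
  classical
  intro n
  induction n with
  | zero =>
    intro p hp hn
    refine G.slack26_nonneg_of_closed_at_c hp fun e he => ?_
    by_contra hpe
    have hmem : e ∈ G.liveCEdges p c := by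
      unfold liveCEdges
      simp only [Finset.mem_filter, Finset.mem_univ, true_and]
      exact ⟨he, hpe⟩
    rw [Finset.card_eq_zero] at hn
    rw [hn] at hmem
    exact Finset.notMem_empty e hmem
  | succ n ih =>
    intro p hp hn
    have hne : (G.liveCEdges p c).Nonempty := by
      rw [← Finset.card_pos, hn]
      exact Nat.succ_pos n
    obtain ⟨e, he⟩ := hne
    have he' : G.IsCEdge c e ∧ p e ≠ 0 := by
      unfold liveCEdges at he
      simpa only [Finset.mem_filter, Finset.mem_univ, true_and] using he
    have hp0 : IsProb (Function.update p e 0) := hp.update e ⟨le_rfl, zero_le_one⟩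
    have hcard : (G.liveCEdges (Function.update p e 0) c).card = n := by
      rw [G.liveCEdges_update_zero, Finset.card_erase_of_mem he, hn]
      rfl
    exact G.c026_of_con hp (hcon p hp e he'.1 he'.2) (ih _ hp0 hcard)

end MultiGraph

/-- **(Con) at every edge at `c`** — mine-3's candidate step (Con)_cv as a statement: for every
finite multigraph, every `p ∈ [0,1]^E`, every marks `a, b, c` and every non-loop edge `e` at `c`,
`f(p[e:=1]) ≥ I_D · I_A`.  (Census of record: every c–non-mark edge, 0 violations — CONJECTURES
row C-026; at the mark–mark edges `ca`, `cb` the step is the free one of §15.2 (ii).) -/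
def ConCEdges : Prop :=
  ∀ {V E : Type} [Fintype E] [DecidableEq E] (G : MultiGraph V E) (p : E → ℝ), IsProb p →
    ∀ a b c : V, ∀ e : E, G.IsCEdge c e → G.Con26 p e a b c

/-- **The bridge of record** (mine-3 §16.1, lead 2082 (1)): (Con) at every edge at `c` gives
C-026 — `0 ≤ slack26`, i.e. `(x + y₁)(y₁ + z) ≤ y₁ + y₂ + y₃` — for every finite multigraph,
every `p ∈ [0,1]^E` and every marks; no choice rule, no existence quantifier. -/
theorem slack26_nonneg_of_conCEdges (h : ConCEdges) :
    ∀ {V E : Type} [Fintype E] [DecidableEq E] (G : MultiGraph V E) (p : E → ℝ), IsProb p →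
      ∀ a b c : V, 0 ≤ G.slack26 p a b c :=
  fun G p hp a b c =>
    G.slack26_nonneg_of_con_at_c (fun p' hp' e he _ => h G p' hp' a b c e he) _ p hp rfl

/-- The same bridge in the rows of `law3` (the literal shape of `C026`). -/
theorem c026_rows_of_conCEdges (h : ConCEdges) :
    ∀ {V E : Type} [Fintype E] [DecidableEq E] (G : MultiGraph V E) (p : E → ℝ), IsProb p →
      ∀ a b c : V,
        (G.law3 p a b c 0 + G.law3 p a b c 1) * (G.law3 p a b c 1 + G.law3 p a b c 4) ≤
          G.law3 p a b c 1 + G.law3 p a b c 2 + G.law3 p a b c 3 := by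
  intro V E _ _ G p hp a b c
  have := slack26_nonneg_of_conCEdges h G p hp a b c
  unfold MultiGraph.slack26 at this
  linarith

end PercRepro
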